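import Summits.HodgeConjecture.CorCM.MumfordTateRankFiveHodge
import Summits.HodgeConjecture.CorCM.MumfordTateRankTwo
import Literature.AlgebraicGeometry.Motives.HodgeStructureOfAbelianVarietyBiproduct
import Literature.AlgebraicGeometry.Motives.HodgeLieDirectSum
import HarnessLib

/-!
# The converse of the rung `dim Lie Hg(H¹X) = 4`: `X ∼ B^{a+1} × E^{b+1}` (`B` a non-CM elliptic curve or QM surface, `E` a CM
# elliptic curve) has `dim_ℚ Lie Hg(H¹(X)) = 4` — the iff-classification of complex abelian varieties with `Hg = SL₂ × U(1)`

COR-CM (cell `pub-hodgecm2`, seat `b27` gen 35, count-neutral lane MT-RANK-FIVE-DIVISORS; theorems only, no definition, no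
named fact; UNCONDITIONAL — nothing here uses or asserts HC_CM).  Sequel of `CorCM/MumfordTateRankFive` (gen 33: a complex
abelian variety `X` NOT of CM type with `dim_ℚ Lie Hg(H¹X) = 4` is isogenous to `B^{a+1} × E^{b+1}` along its isotypic
decomposition) and of the Literature file `Motives/HodgeLieDirectSum` (gen 35: `𝔥(⊕_j H_j) ↪ Π_j 𝔥(H_j)`, `𝔥(H^{⊕m}) ↪ 𝔥(H)`,
`dim 𝔥(e^* H) = dim 𝔥(H)`).

* §1 **`finrank_hodgeLie_hodge_one_le_sum_of_isIsogenous_biproduct_powers`** — for EVERY complex abelian variety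
  `X ∼ ⨁ₗ Bₗ^{nₗ+1}` (any `Bₗ`): `dim_ℚ Lie Hg(H¹X) ≤ Σₗ dim_ℚ Lie Hg(H¹Bₗ)` — the Lie-algebra form of
  `Hg(∏ Bₗ^{nₗ}) ⊆ ∏ Hg(Bₗ)` (Moonen–Zarhin §3: `Hg(X₁ × X₂) ⊆ Hg(X₁) × Hg(X₂)`, `Hg(Xᵐ) = Hg(X)`), via Künneth in degree one
  as an isomorphism of `ℚ`-Hodge structures (`pi_hodge_one_eq_comapEquiv_biproduct`) and isogeny invariance
  (`hodge_one_eq_comapEquiv_of_isIsogeny`);  `finrank_hodgeLie_hodge_one_le_one_of_cmCurve` — a CM elliptic curve has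
  `dim Lie Hg(H¹E) ≤ 1` (`dim MT = 2`, `dim Lie Hg + 1 ≤ dim MT`).
* §2 **`four_le_finrank_hodgeLie_hodge_one_of_two_le_card`** — if `X ∼ ⨁ₗ Bₗ^{nₗ+1}` with `Bₗ` simple of positive dimension,
  pairwise non-isogenous, at least TWO indices, and `X` is not of CM type, then `4 ≤ dim_ℚ Lie Hg(H¹X)`: `dim ≥ 3` because
  `Lie Hg ⊄ End_Hdg` (`three_le_finrank_hodgeLie_of_not_mem_endAlg`), and `dim ≤ 3` would force `Z(End⁰X) = ℚ`
  (`exists_eq_smul_one_of_mem_center_endAlg`, Riemann transport `mem_bot_of_mem_center_endAlgebra`), whereas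
  `dim_ℚ Z(End⁰(⨁ₗ Bₗ^{nₗ+1})) = Σₗ dim_ℚ Z(End⁰Bₗ) ≥ #{l} ≥ 2`.
* §3 **`finrank_hodgeLie_hodge_one_eq_four_of_isIsogenous_two_powers`** — THE CONVERSE of gen 33's
  `exists_isIsogenous_two_powers_of_finrank_hodgeLie_eq_four`: `X ∼ ⨁ₗ Bₗ^{nₗ+1}` with exactly two indices `i ≠ j`, `Bᵢ`
  simple NOT of CM type with `dim_ℚ End⁰(Bᵢ) = (dim Bᵢ)²`, `dim Bᵢ ≤ 2`, and `Bⱼ` a CM elliptic curve ⟹ `dim_ℚ Lie Hg(H¹X) = 4`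
  (`≤ 3 + 1` by §1 with `dim Lie Hg(H¹Bᵢ) ≤ 3`, `not_le_endAlg_and_finrank_hodgeLie_le_three_of_factor`; `≥ 4` by §2);
  **`finrank_hodgeLie_hodge_one_eq_four_iff`** — for `X` NOT of CM type: `dim_ℚ Lie Hg(H¹X) = 4` IFF `X` has this shape
  (Moonen–Zarhin §2: the complex abelian varieties with Hodge group `SL₂ × U(1)` up to isogeny); and so, with gen 34 and
  `CorCM/MumfordTateRankFiveDivisorClasses`, every such `X` is stably nondegenerate and satisfies the Hodge conjecture with all
  its powers (`isStablyNondegenerate_of_isIsogenous_two_powers`).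

## References
* [MoonenZarhin1999LowDim] B. Moonen, Yu. Zarhin, Math. Ann. 315 (1999) 711–733, §2 (2.1)–(2.5), §3 first paragraph
  [corpus: paper:arxiv-math_9901113 p. 5–6].
* [Deligne1982HodgeCycles] P. Deligne, *Hodge cycles on abelian varieties*, LNM 900 (1982), I §3.1, Prop. 3.4.
* [MumfordAV1970] D. Mumford, *Abelian Varieties* (1970), §19 Thm. 1, Cor. 1–2 and p. 174.
* [VoisinHodgeI2002] C. Voisin, *Hodge Theory and Complex Algebraic Geometry I*, §7.3.2, §11.3.3 Thm. 11.38–11.40.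
* [DeligneMilne1982Tannakian] P. Deligne, J. S. Milne, *Tannakian categories*, LNM 900, II §6 Thm. 6.20 (Riemann).
-/

noncomputable section

open CategoryTheory CategoryTheory.Limits Module
open scoped BigOperators

namespace Summit.HodgeConjecture.CorCM

open Literature.AlgebraicGeometry.Motives
open Literature.AlgebraicGeometry.Motives.AbelianVariety
open Literature.AlgebraicGeometry.Motives.HodgeStructure
open Literature.AlgebraicGeometry.HodgeTheory
open Literature.AlgebraicGeometry.ComplexMultiplication (nontrivial_endAlgebra_of_dim_pos)
open Literature.AlgebraicGeometry.Milne1999 (IsOfCMType isOfCMType_iff_of_isIsogenous)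
open Literature.AlgebraicGeometry.Pohlmann1968 (hodge_one_eq_comapEquiv_of_isIsogeny)

variable [HodgeTensorFacts.{0, 0}] {X : AbelianVariety ℂ} {n : ℕ}

/-! ## §1 `dim Lie Hg(H¹(⨁ₗ Bₗ^{nₗ+1})) ≤ Σₗ dim Lie Hg(H¹Bₗ)`; CM elliptic curves have `dim Lie Hg ≤ 1` -/

section UpperBound

/-- **`dim_ℚ Lie Hg(H¹X) ≤ Σₗ dim_ℚ Lie Hg(H¹Bₗ)` for every complex abelian variety `X ∼ ⨁ₗ Bₗ^{nₗ+1}`** (any complex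
abelian varieties `Bₗ`): the Lie-algebra form of `Hg(∏ₗ Bₗ^{nₗ}) ⊆ ∏ₗ Hg(Bₗ)` (`Hg(X₁ × X₂) ⊆ Hg(X₁) × Hg(X₂)`, `Hg(Xᵐ) = Hg(X)`).
`H¹(X) ≅ H¹(⨁ A) ≅ ⊕ₗ H¹(Aₗ)` and `H¹(Aₗ) ≅ H¹(Bₗ)^{⊕(nₗ+1)}` as `ℚ`-Hodge structures (isogeny invariance and Künneth in
degree one, `hodge_one_eq_comapEquiv_of_isIsogeny`, `pi_hodge_one_eq_comapEquiv_biproduct`), the dimension of `Lie Hg` is an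
isomorphism invariant (`finrank_hodgeLie_comapEquiv`), and `dim 𝔥(⊕ Hₗ) ≤ Σ dim 𝔥(Hₗ)`, `dim 𝔥(H^{⊕m}) ≤ dim 𝔥(H)`
(`Motives/HodgeLieDirectSum`). [cite: MoonenZarhin1999LowDim, §3] [cite: Deligne1982HodgeCycles, I §3.1 and Prop. 3.4]
[cite: VoisinHodgeI2002, §7.3.2 and §11.3.3 Thm. 11.40] -/
theorem finrank_hodgeLie_hodge_one_le_sum_of_isIsogenous_biproduct_powers (hX : IsSmoothProjective n X.X)
    {r : ℕ} {B : Fin r → AbelianVariety ℂ} {nB : Fin r → ℕ}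
    (hXB : IsIsogenous X (⨁ fun l => ⨁ fun _ : Fin (nB l + 1) => B l)) :
    haveI := BettiUniverse.finite hX 1
    haveI : ∀ l, Module.Finite ℚ (bettiCohomology (B l).X 1) := fun l =>
      BettiUniverse.finite (AbelianVariety.isSmoothProjective_holds (A := B l)) 1
    Module.finrank ℚ (BettiUniverse.hodge exists_isReal_hodgeModel_holds hX 1).hodgeLie ≤
      ∑ l, Module.finrank ℚ (BettiUniverse.hodge exists_isReal_hodgeModel_holds
        (AbelianVariety.isSmoothProjective_holds (A := B l)) 1).hodgeLie := by
  classical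
  set A : Fin r → AbelianVariety ℂ := fun l => ⨁ fun _ : Fin (nB l + 1) => B l with hA
  have hAsp : ∀ l, IsSmoothProjective (A l).dim (A l).X := fun l => AbelianVariety.isSmoothProjective_holds
  have hBsp : ∀ l, IsSmoothProjective (B l).dim (B l).X := fun l => AbelianVariety.isSmoothProjective_holds
  have hY : IsSmoothProjective (⨁ A).dim (⨁ A).X := AbelianVariety.isSmoothProjective_holds
  haveI := BettiUniverse.finite hX 1
  haveI := BettiUniverse.finite hY 1
  haveI : ∀ l, Module.Finite ℚ (bettiCohomology (A l).X 1) := fun l => BettiUniverse.finite (hAsp l) 1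
  haveI : ∀ l, Module.Finite ℚ (bettiCohomology (B l).X 1) := fun l => BettiUniverse.finite (hBsp l) 1
  -- (1) isogeny invariance `X ∼ ⨁ A`
  obtain ⟨g, hg⟩ := hXB
  have h1 : Module.finrank ℚ (BettiUniverse.hodge exists_isReal_hodgeModel_holds hX 1).hodgeLie =
      Module.finrank ℚ (BettiUniverse.hodge exists_isReal_hodgeModel_holds hY 1).hodgeLie := by
    rw [hodge_one_eq_comapEquiv_of_isIsogeny hX hY hg, finrank_hodgeLie_comapEquiv]
  -- (2) Künneth: `H¹(⨁ A) ≅ ⊕ₗ H¹(A l)`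
  have h2 : Module.finrank ℚ (BettiUniverse.hodge exists_isReal_hodgeModel_holds hY 1).hodgeLie =
      Module.finrank ℚ (HodgeStructure.pi fun l => BettiUniverse.hodge exists_isReal_hodgeModel_holds (hAsp l) 1).hodgeLie := by
    rw [pi_hodge_one_eq_comapEquiv_biproduct hAsp hY exists_isReal_hodgeModel_holds hodgePQ_independent_of_hodgeModel_holds,
      finrank_hodgeLie_comapEquiv]
  -- (3) each `A l = ⨁ (B l)`: `dim 𝔥(H¹(A l)) ≤ dim 𝔥(H¹(B l))`
  have h3 : ∀ l, Module.finrank ℚ (BettiUniverse.hodge exists_isReal_hodgeModel_holds (hAsp l) 1).hodgeLie ≤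
      Module.finrank ℚ (BettiUniverse.hodge exists_isReal_hodgeModel_holds (hBsp l) 1).hodgeLie := fun l => by
    have hpi := pi_hodge_one_eq_comapEquiv_biproduct (A := fun _ : Fin (nB l + 1) => B l) (fun _ => hBsp l) (hAsp l)
      exists_isReal_hodgeModel_holds hodgePQ_independent_of_hodgeModel_holds
    have heq := finrank_hodgeLie_comapEquiv (BettiUniverse.hodge exists_isReal_hodgeModel_holds (hAsp l) 1)
      (LinearEquiv.ofBijective
        (∑ c, BettiUniverse.pull (biproduct.π (fun _ : Fin (nB l + 1) => B l) c).hom.hom.hom 1 ∘ₗ LinearMap.proj c :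
          (∀ _ : Fin (nB l + 1), bettiCohomology (B l).X 1) →ₗ[ℚ] bettiCohomology (A l).X 1)
        (bijective_sum_pull_biproduct_π fun _ : Fin (nB l + 1) => B l))
    rw [← hpi] at heq
    rw [← heq]
    exact finrank_hodgeLie_pi_const_le _
  calc Module.finrank ℚ (BettiUniverse.hodge exists_isReal_hodgeModel_holds hX 1).hodgeLie
      = Module.finrank ℚ (HodgeStructure.pi fun l =>
          BettiUniverse.hodge exists_isReal_hodgeModel_holds (hAsp l) 1).hodgeLie := h1.trans h2
    _ ≤ ∑ l, Module.finrank ℚ (BettiUniverse.hodge exists_isReal_hodgeModel_holds (hAsp l) 1).hodgeLie :=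
        finrank_hodgeLie_pi_le_sum _
    _ ≤ ∑ l, Module.finrank ℚ (BettiUniverse.hodge exists_isReal_hodgeModel_holds (hBsp l) 1).hodgeLie :=
        Finset.sum_le_sum fun l _ => h3 l

/-- **A CM elliptic curve has `dim_ℚ Lie Hg(H¹E) ≤ 1`** (`Hg(E) = U_F`, a one-dimensional torus): `dim MT(H¹E) = 2`
(`mtRank_hodge_one_eq_two_of_isIsogenous_powSucc`) and `dim Lie Hg + 1 ≤ dim MT` (`finrank_hodgeLie_add_one_le_mtRank`).
[cite: MoonenZarhin1999LowDim, §2 (2.1)] -/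
theorem finrank_hodgeLie_hodge_one_le_one_of_cmCurve {E : AbelianVariety ℂ} (hE1 : E.dim = 1) (hEcm : IsOfCMType E) :
    haveI := BettiUniverse.finite (AbelianVariety.isSmoothProjective_holds (A := E)) 1
    Module.finrank ℚ (BettiUniverse.hodge exists_isReal_hodgeModel_holds
      (AbelianVariety.isSmoothProjective_holds (A := E)) 1).hodgeLie ≤ 1 := by
  haveI := BettiUniverse.finite (AbelianVariety.isSmoothProjective_holds (A := E)) 1
  haveI : Nontrivial (bettiCohomology E.X 1) := nontrivial_bettiCohomology_one (by omega)
  obtain ⟨ψ⟩ := BettiUniverse.hodge_isPolarizable exists_isReal_hodgeModel_holds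
    (AbelianVariety.isSmoothProjective_holds (A := E)) 1
  have h2 := mtRank_hodge_one_eq_two_of_isIsogenous_powSucc (AbelianVariety.isSmoothProjective_holds (A := E)) hE1 hEcm
    (N := 0) (IsIsogenous.refl E)
  have hle := finrank_hodgeLie_add_one_le_mtRank
    (BettiUniverse.hodge exists_isReal_hodgeModel_holds (AbelianVariety.isSmoothProjective_holds (A := E)) 1) ψ (by simp)
  omega

end UpperBound

/-! ## §2 Two non-isogenous simple factors and not CM: `dim Lie Hg(H¹X) ≥ 4` -/

section LowerBound

/-- **`4 ≤ dim_ℚ Lie Hg(H¹X)` for `X` NOT of CM type with at least two isotypic components**: if `X ∼ ⨁ₗ Bₗ^{nₗ+1}` with `Bₗ`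
simple of positive dimension, pairwise non-isogenous, indexed by `Fin r` with `2 ≤ r`, and `X` is not of CM type, then
`dim Lie Hg(H¹X) ≥ 4`.  Non-CM gives `Lie Hg ⊄ End_Hdg`, hence `dim ≥ 3` (`three_le_finrank_hodgeLie_of_not_mem_endAlg`); if
`dim ≤ 3` then central Hodge endomorphisms are scalars (`exists_eq_smul_one_of_mem_center_endAlg`), so `Z(End⁰X) = ℚ` by
Riemann (`mem_bot_of_mem_center_endAlgebra`) — but `dim_ℚ Z(End⁰(⨁ₗ Bₗ^{nₗ+1})) = Σₗ dim_ℚ Z(End⁰Bₗ) ≥ r ≥ 2`.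
[cite: MoonenZarhin1999LowDim, §2] [cite: MumfordAV1970, §19 Thm. 1 Cor. 1–2 and p. 174] [cite: DeligneMilne1982Tannakian, II §6 Thm. 6.20] -/
theorem four_le_finrank_hodgeLie_hodge_one_of_two_le_card (hX : IsSmoothProjective n X.X) (hcm : ¬ IsOfCMType X)
    {r : ℕ} {B : Fin r → AbelianVariety ℂ} {nB : Fin r → ℕ} (hS : ∀ l, (B l).IsSimple) (hd : ∀ l, 0 < (B l).dim)
    (hni : ∀ l l', l ≠ l' → ¬ IsIsogenous (B l) (B l'))
    (hXB : IsIsogenous X (⨁ fun l => ⨁ fun _ : Fin (nB l + 1) => B l)) (hr : 2 ≤ r) :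
    haveI := BettiUniverse.finite hX 1
    4 ≤ Module.finrank ℚ (BettiUniverse.hodge exists_isReal_hodgeModel_holds hX 1).hodgeLie := by
  classical
  have hn : X.dim = n := schemeDim_eq_holds hX
  subst hn
  haveI := BettiUniverse.finite hX 1
  -- `0 < dim X`
  have h0 : 0 < X.dim := by
    obtain ⟨f, hf⟩ := hXB
    rw [dim_eq_of_isIsogeny hf, AndreRiemann.dim_biproduct_fin]
    have i0 : Fin r := ⟨0, by omega⟩
    refine Finset.sum_pos' (fun l _ => Nat.zero_le _) ⟨i0, Finset.mem_univ _, ?_⟩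
    rw [AndreRiemann.dim_biproduct_const]
    exact Nat.mul_pos (Nat.succ_pos _) (hd i0)
  haveI := nontrivial_bettiCohomology_one h0
  set H := BettiUniverse.hodge exists_isReal_hodgeModel_holds hX 1 with hH
  obtain ⟨ψ⟩ := BettiUniverse.hodge_isPolarizable exists_isReal_hodgeModel_holds hX 1
  have hne : ¬ H.hodgeLie ≤ Subalgebra.toSubmodule H.endAlg := fun h =>
    hcm ((isOfCMType_iff_mumfordTateLieAlgebra_le_endAlg hX).2 ((hodgeLie_le_endAlg_iff H).1 h))
  obtain ⟨Y, hY, hYE⟩ := SetLike.not_le_iff_exists.1 hne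
  rw [Subalgebra.mem_toSubmodule] at hYE
  have h3 : 3 ≤ Module.finrank ℚ H.hodgeLie := three_le_finrank_hodgeLie_of_not_mem_endAlg H hY hYE
  by_contra hlt
  have hle3 : Module.finrank ℚ H.hodgeLie ≤ 3 := by omega
  -- the centre of `End⁰(X)` would be `ℚ`
  have hbot : Subalgebra.center ℚ X.endAlgebra = ⊥ :=
    le_antisymm (fun w hw => mem_bot_of_mem_center_endAlgebra hX (fun z' hz' hzc =>
      exists_eq_smul_one_of_mem_center_endAlg H ψ (by simp) (BettiUniverse.hodge_isEffective _ hX 1) hne hle3 hz' hzc) hw)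
      bot_le
  have hZ : Module.finrank ℚ (Subalgebra.center ℚ X.endAlgebra) = 1 := by
    haveI := nontrivial_endAlgebra_of_dim_pos (B := X) h0
    rw [hbot, Subalgebra.finrank_bot]
  -- but it has dimension `Σₗ dim Z(End⁰ B l) ≥ r ≥ 2`
  have horth := orthogonal_of_isSimple_of_not_isIsogenous hS hni
  obtain ⟨e⟩ := hXB.nonempty_endAlgebra_algEquiv
  have hZsum : Module.finrank ℚ (Subalgebra.center ℚ X.endAlgebra) =
      ∑ l, Module.finrank ℚ (Subalgebra.center ℚ (B l).endAlgebra) := by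
    rw [(IsotypicCM.center_transfer_algEquiv e).1, CMProductEnd.finrank_center_endAlgebra_biproduct_powers horth]
  have hge : r ≤ ∑ l, Module.finrank ℚ (Subalgebra.center ℚ (B l).endAlgebra) := by
    have h := Finset.sum_le_sum fun l (_ : l ∈ (Finset.univ : Finset (Fin r))) =>
      Nat.one_le_iff_ne_zero.2 (finrank_center_endAlgebra_pos (hd l)).ne'
    rwa [Finset.sum_const, Finset.card_univ, Fintype.card_fin, smul_eq_mul, mul_one] at h
  omega

end LowerBound

/-! ## §3 The converse and the iff-classification of `dim Lie Hg(H¹X) = 4` -/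

section Converse

/-- **THE CONVERSE of `exists_isIsogenous_two_powers_of_finrank_hodgeLie_eq_four`: `X ∼ B^{a+1} × E^{b+1}` has
`dim_ℚ Lie Hg(H¹(X)) = 4`.**  Precisely: if `X ∼ ⨁ₗ Bₗ^{nₗ+1}` along a family `Bₗ` (`l : Fin r`) of simple, pairwise
non-isogenous abelian varieties of positive dimension taking exactly the two values `i ≠ j`, with `Bᵢ` NOT of CM type,
`dim_ℚ End⁰(Bᵢ) = (dim Bᵢ)²`, `dim Bᵢ ≤ 2` (a non-CM elliptic curve or a QM abelian surface) and `Bⱼ` an elliptic curve of CM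
type, then `dim_ℚ Lie Hg(H¹X) = 4` (`Hg(X) ≅ SL₂ × U(1)` up to isogeny).  UPPER BOUND `≤ dim 𝔥(H¹Bᵢ) + dim 𝔥(H¹Bⱼ) ≤ 3 + 1`
(§1 and `not_le_endAlg_and_finrank_hodgeLie_le_three_of_factor`); LOWER BOUND §2 (`X` is not CM since `Bᵢ` is not,
`isOfCMType_biproduct_powers_iff`). [cite: MoonenZarhin1999LowDim, §2 (2.1)–(2.5) and §3]
[cite: Deligne1982HodgeCycles, I §3.1 and Prop. 3.4] [cite: MumfordAV1970, §19 Thm. 1 Cor. 1–2 and p. 174] -/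
theorem finrank_hodgeLie_hodge_one_eq_four_of_isIsogenous_two_powers (hX : IsSmoothProjective n X.X)
    {r : ℕ} {B : Fin r → AbelianVariety ℂ} {nB : Fin r → ℕ} {i j : Fin r}
    (hS : ∀ l, (B l).IsSimple) (hd : ∀ l, 0 < (B l).dim) (hni : ∀ l l', l ≠ l' → ¬ IsIsogenous (B l) (B l'))
    (hXB : IsIsogenous X (⨁ fun l => ⨁ fun _ : Fin (nB l + 1) => B l)) (hij : i ≠ j) (hall : ∀ l, l = i ∨ l = j)
    (hcmi : ¬ IsOfCMType (B i)) (hEi : Module.finrank ℚ (B i).endAlgebra = (B i).dim ^ 2) (hdimi : (B i).dim ≤ 2)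
    (hdj1 : (B j).dim = 1) (hcmj : IsOfCMType (B j)) :
    haveI := BettiUniverse.finite hX 1
    Module.finrank ℚ (BettiUniverse.hodge exists_isReal_hodgeModel_holds hX 1).hodgeLie = 4 := by
  classical
  haveI := BettiUniverse.finite hX 1
  haveI : ∀ l, Module.Finite ℚ (bettiCohomology (B l).X 1) := fun l =>
    BettiUniverse.finite (AbelianVariety.isSmoothProjective_holds (A := B l)) 1
  -- `X` is not of CM type
  have hcm : ¬ IsOfCMType X := fun h => hcmi
    (((isOfCMType_iff_of_isIsogenous hXB).1 h |> (CMProductEnd.isOfCMType_biproduct_powers_iff B nB).1) i)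
  have hr : 2 ≤ r := by
    by_contra hr
    have : Subsingleton (Fin r) := ⟨fun a b => Fin.ext (by have := a.2; have := b.2; omega)⟩
    exact hij (Subsingleton.elim i j)
  refine le_antisymm ?_ (four_le_finrank_hodgeLie_hodge_one_of_two_le_card hX hcm hS hd hni hXB hr)
  -- upper bound
  have hle := finrank_hodgeLie_hodge_one_le_sum_of_isIsogenous_biproduct_powers hX hXB
  have huniv : (Finset.univ : Finset (Fin r)) = {i, j} := by
    ext l
    simp only [Finset.mem_univ, Finset.mem_insert, Finset.mem_singleton, true_iff]
    exact hall l
  rw [huniv, Finset.sum_pair hij] at hle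
  obtain ⟨-, h3i⟩ := not_le_endAlg_and_finrank_hodgeLie_le_three_of_factor (hS i) (hd i) hcmi hEi hdimi
  have h1j := finrank_hodgeLie_hodge_one_le_one_of_cmCurve hdj1 hcmj
  omega

/-- **The iff-classification of the rung `dim Lie Hg(H¹X) = 4`** (Moonen–Zarhin §2: the complex abelian varieties with
Hodge group `SL₂ × U(1)`): for a complex abelian variety `X` NOT of CM type, `dim_ℚ Lie Hg(H¹(X)) = 4` if and only if, along
its isotypic decomposition `X ∼ ⨁ₗ Bₗ^{nₗ+1}` (`Bₗ` simple of positive dimension, pairwise non-isogenous), there are EXACTLY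
two indices `i ≠ j` with `Bᵢ` NOT of CM type, `dim_ℚ End⁰(Bᵢ) = (dim Bᵢ)²`, `dim Bᵢ ≤ 2` and `Bⱼ` an elliptic curve with
`dim_ℚ End⁰(Bⱼ) = 2` of CM type — i.e. `X ∼ B^{a+1} × E^{b+1}`, `B` a non-CM elliptic curve or a QM abelian surface, `E` a CM
elliptic curve (`→`: gen 33's `exists_isIsogenous_two_powers_of_finrank_hodgeLie_eq_four`; `←`: the previous theorem).
[cite: MoonenZarhin1999LowDim, §2 (2.1)–(2.5) and §3] [cite: MumfordAV1970, §19 Thm. 1 Cor. 1–2 and p. 174] -/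
theorem finrank_hodgeLie_hodge_one_eq_four_iff (hX : IsSmoothProjective n X.X) (hcm : ¬ IsOfCMType X) :
    haveI := BettiUniverse.finite hX 1
    Module.finrank ℚ (BettiUniverse.hodge exists_isReal_hodgeModel_holds hX 1).hodgeLie = 4 ↔
      ∃ (r : ℕ) (B : Fin r → AbelianVariety ℂ) (nB : Fin r → ℕ) (i j : Fin r),
        (∀ l, (B l).IsSimple) ∧ (∀ l, 0 < (B l).dim) ∧ (∀ l l', l ≠ l' → ¬ IsIsogenous (B l) (B l')) ∧
        IsIsogenous X (⨁ fun l => ⨁ fun _ : Fin (nB l + 1) => B l) ∧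
        i ≠ j ∧ (∀ l, l = i ∨ l = j) ∧
        ¬ IsOfCMType (B i) ∧ Module.finrank ℚ (B i).endAlgebra = (B i).dim ^ 2 ∧ (B i).dim ≤ 2 ∧
        (B j).dim = 1 ∧ Module.finrank ℚ (B j).endAlgebra = 2 ∧ IsOfCMType (B j) :=
  ⟨fun h4 => exists_isIsogenous_two_powers_of_finrank_hodgeLie_eq_four hX hcm h4,
    fun ⟨_, _, _, _, _, hS, hd, hni, hXB, hij, hall, hcmi, hEi, hdimi, hdj1, _, hcmj⟩ =>
      finrank_hodgeLie_hodge_one_eq_four_of_isIsogenous_two_powers hX hS hd hni hXB hij hall hcmi hEi hdimi hdj1 hcmj⟩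

/-- **… hence such an `X` satisfies the Hodge conjecture together with all its powers**, UNCONDITIONALLY (gen 34's
`hodgeConjectureFor_powSucc_of_not_isOfCMType_of_finrank_hodgeLie_eq_four` through the converse).
[cite: MoonenZarhin1999LowDim, §2 and §3 Thm. (3.2)] -/
theorem hodgeConjectureFor_powSucc_of_isIsogenous_two_powers (hX : IsSmoothProjective n X.X)
    {r : ℕ} {B : Fin r → AbelianVariety ℂ} {nB : Fin r → ℕ} {i j : Fin r}
    (hS : ∀ l, (B l).IsSimple) (hd : ∀ l, 0 < (B l).dim) (hni : ∀ l l', l ≠ l' → ¬ IsIsogenous (B l) (B l'))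
    (hXB : IsIsogenous X (⨁ fun l => ⨁ fun _ : Fin (nB l + 1) => B l)) (hij : i ≠ j) (hall : ∀ l, l = i ∨ l = j)
    (hcmi : ¬ IsOfCMType (B i)) (hEi : Module.finrank ℚ (B i).endAlgebra = (B i).dim ^ 2) (hdimi : (B i).dim ≤ 2)
    (hdj1 : (B j).dim = 1) (hcmj : IsOfCMType (B j)) (N : ℕ) :
    HodgeConjectureFor (X.powSucc N).dim (X.powSucc N).X :=
  hodgeConjectureFor_powSucc_of_not_isOfCMType_of_finrank_hodgeLie_eq_four hX
    (fun h => hcmi (((isOfCMType_iff_of_isIsogenous hXB).1 h |> (CMProductEnd.isOfCMType_biproduct_powers_iff B nB).1) i))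
    (finrank_hodgeLie_hodge_one_eq_four_of_isIsogenous_two_powers hX hS hd hni hXB hij hall hcmi hEi hdimi hdj1 hcmj) N

end Converse

end Summit.HodgeConjecture.CorCM

end
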